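import Summits.MatrixMultiplication.OmegaCensus.STPPSmallPatternKernelSearch
import Summits.MatrixMultiplication.OmegaCensus.STPPSmallPatternKernelProduct

/-!
# ω-census, `(2,1,1)^6` is infeasible in `ℤ/2 × ℤ/12` — kernel search, part 9 of 13

HONEST FRAMING (pub-omega census; verbatim): lottery ticket; floor = certified bounds/negative ranges.
Census STRUCTURE bookkeeping of the STPP track (seat pub-omega-eng2 = ENG2, gen 33, on the kernel engine + reflection of seat
pub-omega-stpp-3 gen 23; STRUCTURE row B5, the threshold column `T1(H) = max {k : (2,1,1)^k ⊆ H}`, lower side of the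
`k = 6` ORDER LAW `(2,1,1)⁶ ⊆ G ↔ 30 ≤ |G|`), not progress on `ω`: small patterns in small groups bound no exponent.

Chunks of the kernel mask search `STPP211Neg.search (prodGC 2 (zcode 12)) 6` (`decide +kernel`; ≈ 206 s of kernel time predicted);
assembled in `STPPSmallPatternNone211K6P2x12.lean`.  Chunk entries `(d, x1)`: representative `d` of `A₀ = {0, d}`, first-level exclusion mask `x1`.

References: H. Cohn, R. Kleinberg, B. Szegedy, C. Umans, FOCS 2005 (arXiv:math/0511460), Def. 5.1.  Record: pub-omega HOME
`pub-omega-eng2-g33/results/none6/` (ENG2's C mirror `k211c.c` of the kernel tree — validated against stpp-3's Python mirror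
`k211v3.py` on the landed `k = 5` cells to the translation count — gives COMPLETE NONE on this cell with 31798860 mask
translations; per-`(d,c₁,c₂)` cost tables, planner `plan6.py`; farm calibration 67 µs per translation; not used by the proofs).
-/

set_option Elab.async false  -- several kernel pieces: elaborate sequentially (memory)

namespace Summit.MatrixMultiplication.OmegaCensus

namespace STPP211Neg

/-- Chunk list 18 of `ℤ/2 × ℤ/12`, `k = 6` (1277922 mask translations in the mirror ≈ 86 s predicted). -/
def P2_12k6.ch18 : List (ℕ × ℕ) :=
  [(9, 255)]

/-- Kernel search over chunk list 18 of `ℤ/2 × ℤ/12`, `k = 6`. -/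
theorem P2_12k6.s18 : search (prodGC 2 (zcode 12)) 6 P2_12k6.ch18 = true := by
  decide +kernel

/-- Chunk list 19 of `ℤ/2 × ℤ/12`, `k = 6` (901001 mask translations in the mirror ≈ 61 s predicted). -/
def P2_12k6.ch19 : List (ℕ × ℕ) :=
  [(12, 16777213)]

/-- Kernel search over chunk list 19 of `ℤ/2 × ℤ/12`, `k = 6`. -/
theorem P2_12k6.s19 : search (prodGC 2 (zcode 12)) 6 P2_12k6.ch19 = true := by
  decide +kernel

/-- Chunk list 20 of `ℤ/2 × ℤ/12`, `k = 6` (876520 mask translations in the mirror ≈ 59 s predicted). -/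
def P2_12k6.ch20 : List (ℕ × ℕ) :=
  [(12, 16777211)]

/-- Kernel search over chunk list 20 of `ℤ/2 × ℤ/12`, `k = 6`. -/
theorem P2_12k6.s20 : search (prodGC 2 (zcode 12)) 6 P2_12k6.ch20 = true := by
  decide +kernel

/-- The chunk lists of this part, concatenated. -/
def P2_12k6.part9 : List (ℕ × ℕ) :=
  P2_12k6.ch18 ++ P2_12k6.ch19 ++ P2_12k6.ch20

/-- The kernel search over this part's chunks (assembled). -/
theorem P2_12k6.ps9 : search (prodGC 2 (zcode 12)) 6 P2_12k6.part9 = true := by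
  simp only [P2_12k6.part9, search_append, P2_12k6.s18, P2_12k6.s19, P2_12k6.s20, Bool.and_self]

end STPP211Neg

end Summit.MatrixMultiplication.OmegaCensus
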